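import Literature.AlgebraicGeometry.Resolution.AlterationsNormalFormBlowupFormal
import Literature.AlgebraicGeometry.Resolution.AlterationsNormalFormStrictTransform
import Literature.AlgebraicGeometry.Resolution.AlterationsNormalFormBlowupChartsReduction
import Literature.AlgebraicGeometry.Resolution.AlterationsIsNormalFormParts
import HarnessLib

/-!
# De Jong's alteration theorem: 3.5/4.25–4.28 (`DeJong1996CodimThreeModification`) from the
leaves now live

Topic: `Literature/AlgebraicGeometry/Resolution`. Pure glue. The named fact
`DeJong1996CodimThreeModification` of `AlterationsSemiStableResolution.lean` (de Jong 1996, 3.5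
with 4.25–4.28, first sentence: a semi-stable pair with `codim(Sing(X), X) ≥ 3` has a projective
modification with nonsingular source on which the boundary becomes a normal crossings divisor)
has been decomposed across `AlterationsNormalFormBlowup.lean` (Situation 4.25, the 4.28
induction), `AlterationsNormalFormBlowupParts.lean` (Claim 4.27 cut into [C1]/[C2], the count
of singular components proved), `AlterationsNormalFormBlowupCentre.lean` ([C1] = [S2] + [S3],
closed points suffice), `AlterationsNormalFormStrictTransform.lean` ([S2] from the regularity
of `E ∩ E'` and Görtz–Wedhorn 13.96 (2), by Liu 8.1.19 (a)),
`AlterationsNormalFormBlowupFormal.lean` ([S3] from [S1] and the formal chart computation, by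
the transfer to `Spec 𝒪̂_{X,x}`) and `AlterationsNormalFormBlowupChartsReduction.lean` ([C2]
confined to the points over the centre). This file records the resulting assemblies of
Claim 4.27 and of the target fact from the SIX leaves of 4.27 now live —

* `DeJong1996NormalFormPairCentreFormalIdeal` [S1] ("Since `E` is smooth, its ideal in the rings
  of (ii) is given by `(u, v, t₁, t₂)` after renumbering", with the dictionary of 3.5),
* `DeJong1996NodalBlowupSingularLocus` (the singular locus of the blow-up of the formal model
  `k⟦u, v, t⟧/(uv - t₁ ⋯ t_s)` in `(u, v, t_{a₀}, t_{b₀})`, p. 76),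
* `DeJong1996NormalFormPairCentreIntersection` ("the nonsingular closed subscheme `E' ∩ E`"),
* `StrictTransformClosedImmersion` (Görtz–Wedhorn I, Prop. 13.96 (2)),
* `DeJong1996NormalFormPairBlowupChartsOverCentre` (4.25 (i), (ii) for `(X', π⁻¹ Z)` at the
  closed points over the centre: the two charts of p. 76),

— together with 3.5 (`DeJong1996SemiStablePairIsNormalForm`, itself assembled from its parts in
`AlterationsIsNormalFormParts.lean`), the formal/étale equivalence for normal crossings
(`DeJong1996FormalNormalCrossings`) and the projectivity of blow-ups (`BlowupProjectiveOverField`).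

## Sources

* A. J. de Jong, *Smoothness, semi-stability and alterations*, Publ. Math. IHÉS 83 (1996) 51–93:
  3.5 (p. 64), 4.24–4.28 (pp. 75–76).
-/

noncomputable section

namespace Literature.AlgebraicGeometry.Resolution

universe u

/-- **Claim 4.27 (`DeJong1996NormalFormPairBlowup`) from its five live leaves**: [S1] with the
dictionary of 3.5, the formal chart computation, the regularity of `E' ∩ E`, Görtz–Wedhorn
13.96 (2), and the charts [C2] over the centre; the variety conditions of `X'`, the count of
singular components, the description of `Sing(X')` off the exceptional locus, "closed points
suffice", the identification `Ẽ' ≅ Bl_{E'∩E}(E')`, the transfer to `Spec 𝒪̂_{X,x}`, the divisor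
clause and the formal conditions off the centre are all proved.
[cite: DeJong1996, 4.26–4.27, pp. 75–76] -/
theorem DeJong1996NormalFormPairBlowup.of_liveLeaves
    (H₁ : DeJong1996NormalFormPairCentreFormalIdeal.{u})
    (H₂ : DeJong1996NodalBlowupSingularLocus.{u})
    (H₃ : DeJong1996NormalFormPairCentreIntersection.{u}) (H₄ : StrictTransformClosedImmersion.{u})
    (H₅ : DeJong1996NormalFormPairBlowupChartsOverCentre.{u}) :
    DeJong1996NormalFormPairBlowup.{u} :=
  DeJong1996NormalFormPairBlowup.of_singularOverCentre_of_strictTransformRegular_of_charts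
    (DeJong1996NormalFormPairBlowupSingularOverCentre.of_centreFormalIdeal_of_nodalBlowup H₁ H₂)
    (DeJong1996NormalFormPairStrictTransformRegular.of_centreIntersection_of_strictTransform
      H₃ H₄)
    (DeJong1996NormalFormPairBlowupCharts.of_overCentre H₅)

/-- **`DeJong1996CodimThreeModification` (de Jong 1996, 3.5 with 4.25–4.28, first sentence) from
the leaves now live**: 3.5 (`DeJong1996SemiStablePairIsNormalForm`), the five leaves of
Claim 4.27 (`DeJong1996NormalFormPairBlowup.of_liveLeaves`), the formal/étale equivalence for
normal crossings divisors (`DeJong1996FormalNormalCrossings`) and the projectivity of blow-ups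
(`BlowupProjectiveOverField`, Hartshorne II 7.16 (c)); the 4.28 induction is
`DeJong1996CodimThreeModification.of_isNormalForm_of_blowup_of_formal`.
[cite: DeJong1996, 3.5 and 4.24–4.28, pp. 64, 75–76] -/
theorem DeJong1996CodimThreeModification.of_liveLeaves
    (hN : DeJong1996SemiStablePairIsNormalForm.{u})
    (H₁ : DeJong1996NormalFormPairCentreFormalIdeal.{u})
    (H₂ : DeJong1996NodalBlowupSingularLocus.{u})
    (H₃ : DeJong1996NormalFormPairCentreIntersection.{u}) (H₄ : StrictTransformClosedImmersion.{u})
    (H₅ : DeJong1996NormalFormPairBlowupChartsOverCentre.{u})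
    (hF : DeJong1996FormalNormalCrossings.{u}) (hP : BlowupProjectiveOverField.{u}) :
    DeJong1996CodimThreeModification.{u} :=
  DeJong1996CodimThreeModification.of_isNormalForm_of_blowup_of_formal hN
    (DeJong1996NormalFormPairBlowup.of_liveLeaves H₁ H₂ H₃ H₄ H₅) hF hP

/-- The same with 3.5 unfolded into its four printed parts (`AlterationsIsNormalFormParts.lean`:
the boundary is a divisor, normal crossings at the nonsingular points, the nodal normal form at
the singular points, the components of `Sing(X)` are regular).
[cite: DeJong1996, 3.5 and 4.24–4.28, pp. 64, 75–76] -/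
theorem DeJong1996CodimThreeModification.of_liveLeaves'
    (h₁ : DeJong1996SemiStableBoundaryIsDivisor.{u})
    (h₂ : DeJong1996SemiStableBoundaryNormalCrossings.{u}) (h₃ : DeJong1996CodimThreeNodalForm.{u})
    (h₅ : DeJong1996CodimThreeSingularComponentsRegular.{u})
    (H₁ : DeJong1996NormalFormPairCentreFormalIdeal.{u})
    (H₂ : DeJong1996NodalBlowupSingularLocus.{u})
    (H₃ : DeJong1996NormalFormPairCentreIntersection.{u}) (H₄ : StrictTransformClosedImmersion.{u})
    (H₅ : DeJong1996NormalFormPairBlowupChartsOverCentre.{u})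
    (hF : DeJong1996FormalNormalCrossings.{u}) (hP : BlowupProjectiveOverField.{u}) :
    DeJong1996CodimThreeModification.{u} :=
  DeJong1996CodimThreeModification.of_liveLeaves
    (DeJong1996SemiStablePairIsNormalForm.of_parts h₁ h₂ h₃ h₅) H₁ H₂ H₃ H₄ H₅ hF hP

/-- `DeJong1996NormalFormPairResolution` (4.25–4.28) from the five leaves of Claim 4.27, the
formal/étale equivalence, the strictification 2.4 (`DeJong1996NormalCrossingsBlowup`) and the
projectivity of blow-ups. [cite: DeJong1996, 4.25–4.28, pp. 75–76] -/
theorem DeJong1996NormalFormPairResolution.of_liveLeaves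
    (H₁ : DeJong1996NormalFormPairCentreFormalIdeal.{u})
    (H₂ : DeJong1996NodalBlowupSingularLocus.{u})
    (H₃ : DeJong1996NormalFormPairCentreIntersection.{u}) (H₄ : StrictTransformClosedImmersion.{u})
    (H₅ : DeJong1996NormalFormPairBlowupChartsOverCentre.{u})
    (hF : DeJong1996FormalNormalCrossings.{u}) (hB : DeJong1996NormalCrossingsBlowup.{u})
    (hP : BlowupProjectiveOverField.{u}) : DeJong1996NormalFormPairResolution.{u} :=
  DeJong1996NormalFormPairResolution.of_blowup_of_formal_of_ncBlowup
    (DeJong1996NormalFormPairBlowup.of_liveLeaves H₁ H₂ H₃ H₄ H₅) hF hB hP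

end Literature.AlgebraicGeometry.Resolution

end
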